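import Summits.AtomisticToContinuum.BoseEinsteinCondensation.Theorems.BECConjugateDominationHardCoreExtensionMaxFormApproximationFiniteRange
import Literature.MathematicalPhysics.QuantumManyBody.PeriodicMaxFormZeroMomentum
import Literature.MathematicalPhysics.QuantumManyBody.PeriodicMaxFormTranslation
import Literature.MathematicalPhysics.QuantumManyBody.BoseGasThermodynamicLimitProofs
import Literature.Analysis.FunctionSpaces.SmoothCutoff
import HarnessLib

/-!
# InvariantApproximationFR, part 1/3: translation-invariant hard-layer cut-offs and zero-momentum
# trigonometric approximants

Helper file (part 1 of 3) for the stub `stub_invariantApproximationFR` (R5) of line `registered` of the crux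
`BECRewardDescent.RewardChordBound` (item stmt-AtomisticToContinuum-12876): the translation-INVARIANT twin of the
landed hard-core MaxFormApproximation `stub_maxFormApproximationFiniteRange`
(`…HardCoreExtensionMaxFormApproximationFiniteRange(Bookkeeping|Step)`). Two devices of that proof are re-supplied
with invariance under the simultaneous ("diagonal") translations `X ↦ (x₁ + t, …, x_N + t)` of all particles:

* `exists_inv_hardLayer_cutoff` — the smooth symmetric periodic cut-off `ξ_s` killing `hardLayer v L (s/2)`, equal
  to `1` on the `s/10`-neighbourhood of the complement of `hardLayer v L s`, with `‖∇ξ_s‖ ≤ C/s`, AND invariant under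
  the diagonal translations. Construction: the De Rosa–Isett mollified indicator
  (`exists_smooth_cutoff_periodic` on `(ℝ³)^N`, which inherits every translation invariance of the set) of the
  complement of `hardLayer v L (3s/4)` at scale `s/40` — the hard layers depend on pair differences only, hence
  are invariant under the period lattice and under the diagonal translations — averaged over the permutations;
* `exists_inv_symm_trigPoly_maxForm_approx` — for a Bose-symmetric `ζ` invariant under all `T_b`
  (`translateLp`), Bose-symmetric trigonometric approximants in the (integrable) maximal form ALL OF WHOSE
  FREQUENCIES HAVE ZERO TOTAL MOMENTUM: the clamp truncation commutes with `T_b` (`compLp_translateLp`) and the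
  dominated Fourier multiplier of `exists_symm_trigPoly_maxForm_approx_dominated` kills every vanishing coefficient.

References: B. Simon, J. Operator Theory 1 (1979) 37–47, Thm. 2.1; [ReedSimonIV1978] Thm. XIII.64, §XIII.16;
L. De Rosa, P. Isett, ARMA 248 (2024), Lemma 5.2.
-/

noncomputable section

open MeasureTheory Filter Set Complex UnitAddTorus Metric
open scoped ENNReal NNReal Topology InnerProductSpace ComplexConjugate ContDiff
open Literature.Analysis.FunctionSpaces Literature.Analysis.OperatorTheory Literature.Analysis.InnerProduct

namespace Summit.AtomisticToContinuum.BoseEinsteinCondensation.Cruxes.RewardChordBound.Birth.InvariantApproximationFR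

open Literature.MathematicalPhysics.QuantumManyBody.BoseGas
open Literature.MathematicalPhysics.QuantumManyBody.BoseGas.HardLayerAux

-- The measure on `ℝ/ℤ` is the Haar PROBABILITY measure, as in `PeriodicFormDomain.lean`.
attribute [local instance] Literature.MathematicalPhysics.QuantumManyBody.BoseGas.formDomain_measureSpace
  Literature.MathematicalPhysics.QuantumManyBody.BoseGas.formDomain_isProbabilityMeasure
  Literature.MathematicalPhysics.QuantumManyBody.BoseGas.formDomain_isProbabilityMeasure_pi

variable {N : ℕ} {L : ℝ} {v : ℝ → ℝ≥0∞}

/-- Local notation for the Hilbert space `L²((ℝ/ℤ)^{3N})`, as in `PeriodicFormDomain.lean`. -/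
local notation "L2T " N':max => Lp ℂ 2 (volume : Measure (UnitAddTorus (Fin N' × Fin 3)))

/-! ### The hard layers are invariant under the diagonal translations -/

/-- Pair-image radii are invariant under simultaneous translation of all particles. [folklore] -/
theorem pairRad_add_const (L : ℝ) (X : Config N) (t : Space) (i j : Fin N) (n : Fin 3 → ℤ) :
    pairRad L (X + fun _ => t) i j n = pairRad L X i j n := by
  simp only [pairRad, Pi.add_apply, add_sub_add_right_eq_sub]

/-- The hard layers are invariant under simultaneous translation of all particles. [folklore] -/
theorem add_const_mem_hardLayer_iff (X : Config N) (t : Space) (s : ℝ) :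
    (X + fun _ => t) ∈ (hardLayer v L s : Set (Config N)) ↔ X ∈ (hardLayer v L s : Set (Config N)) := by
  simp only [hardLayer, mem_setOf_eq, pairRad_add_const]

/-- In the sup norm of `(ℝ³)^N`, points of a `δ`-ball are coordinatewise `δ`-close. [folklore] -/
theorem norm_apply_sub_le_of_mem_ball {X Y : Config N} {δ : ℝ} (hδ : 0 < δ) (hY : Y ∈ ball X δ) (i : Fin N) :
    ‖Y i - X i‖ ≤ δ := by
  rw [← dist_eq_norm]
  exact ((dist_pi_lt_iff hδ).1 (mem_ball.1 hY) i).le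

/-! ### Translation-invariant hard-layer cut-offs -/

/-- **Smooth symmetric periodic cut-offs vanishing near the hard configurations, invariant under the diagonal
translations.** There is `C ≥ 0` such that for every `s > 0` there is `ξ : (ℝ³)^N → [0, 1]`, `C¹`, torus periodic,
permutation symmetric, invariant under `X ↦ (xᵢ + t)ᵢ`, with `ξ = 0` on `hardLayer v L (s/2)`, `ξ = 1` at every
configuration each of whose particles is within `s/10` of a configuration off `hardLayer v L s`, and
`‖∇ξ‖ ≤ C/s`. [folklore] -/
theorem exists_inv_hardLayer_cutoff (v : ℝ → ℝ≥0∞) (L : ℝ) :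
    ∃ C : ℝ, 0 ≤ C ∧ ∀ s : ℝ, 0 < s →
      ∃ ξ : Config N → ℝ, ContDiff ℝ 1 ξ ∧ IsTorusPeriodic L ξ ∧
        (∀ (σ : Equiv.Perm (Fin N)) (X : Config N), ξ (X ∘ σ) = ξ X) ∧
        (∀ (X : Config N) (t : Space), ξ (fun i => X i + t) = ξ X) ∧
        (∀ X, 0 ≤ ξ X ∧ ξ X ≤ 1) ∧ (∀ X ∈ (hardLayer v L (s / 2) : Set (Config N)), ξ X = 0) ∧
        (∀ X ∉ (hardLayer v L s : Set (Config N)), ∀ X' : Config N, (∀ i, ‖X' i - X i‖ < s / 10) → ξ X' = 1) ∧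
        ∀ X, ‖fderiv ℝ ξ X‖ ≤ C / s := by
  classical
  haveI : (volume : Measure (Config N)).IsAddHaarMeasure :=
    show Measure.IsAddHaarMeasure (Measure.pi fun _ : Fin N => (volume : Measure Space)) from
      Measure.pi.isAddHaarMeasure _
  obtain ⟨C, hC0, hC⟩ := exists_smooth_cutoff_periodic (volume : Measure (Config N))
  refine ⟨40 * C, by positivity, fun s hs => ?_⟩
  set A : Set (Config N) := (hardLayer v L (3 * s / 4) : Set (Config N))ᶜ with hA
  obtain ⟨ξ₀, hξ₀diff, hξ₀01, hξ₀1, hξ₀0, hξ₀D, hξ₀inv⟩ :=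
    hC A (measurableSet_hardLayer v L _).compl (s / 40) (by positivity)
  have hδ : (0 : ℝ) < s / 40 := by positivity
  -- vanishing on the inner layer
  have hξ₀zero : ∀ X ∈ (hardLayer v L (s / 2) : Set (Config N)), ξ₀ X = 0 := fun X hX =>
    hξ₀0 X (disjoint_left.2 fun Y hY hYA => hYA (hardLayer_mono v L (by linarith)
      (mem_hardLayer_of_near hX (norm_apply_sub_le_of_mem_ball hδ hY))))
  -- plateau near the complement of the outer layer
  have hξ₀one : ∀ X ∉ (hardLayer v L s : Set (Config N)), ∀ X' : Config N, (∀ i, ‖X' i - X i‖ < s / 10) →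
      ξ₀ X' = 1 := by
    intro X hX X' hX'
    refine hξ₀1 X' fun Y hY hYmem => ?_
    have h1 : X' ∈ (hardLayer v L (3 * s / 4 + 2 * (s / 40)) : Set (Config N)) :=
      mem_hardLayer_of_near hYmem fun i => by rw [norm_sub_rev]; exact norm_apply_sub_le_of_mem_ball hδ hY i
    have h2 : X ∈ (hardLayer v L (3 * s / 4 + 2 * (s / 40) + 2 * (s / 10)) : Set (Config N)) :=
      mem_hardLayer_of_near h1 fun i => by rw [norm_sub_rev]; exact (hX' i).le
    exact hX (hardLayer_mono v L (by linarith) h2)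
  -- the inherited invariances
  have hAinv : ∀ w : Config N, (∀ x : Config N, x + w ∈ (hardLayer v L (3 * s / 4) : Set (Config N)) ↔
      x ∈ (hardLayer v L (3 * s / 4) : Set (Config N))) → ∀ x, ξ₀ (x + w) = ξ₀ x :=
    fun w hw => hξ₀inv w fun x => by simp only [hA, mem_compl_iff, hw x]
  have hξ₀per : ∀ (Y : Config N) (i : Fin N) (k : Fin 3), ξ₀ (Y + Pi.single i (EuclideanSpace.single k L)) = ξ₀ Y :=
    fun Y i k => hAinv _ (fun x => by rw [single_single_eq_latticeVecN, add_latticeVecN_mem_hardLayer_iff]) Y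
  have hξ₀tr : ∀ (X : Config N) (t : Space), ξ₀ (fun i => X i + t) = ξ₀ X := fun X t =>
    hAinv (fun _ => t) (fun x => add_const_mem_hardLayer_iff x t _) X
  have hξ₀D' : ∀ X, ‖fderiv ℝ ξ₀ X‖ ≤ 40 * C / s := fun X => (hξ₀D X).trans_eq (by field_simp)
  -- symmetrise (verbatim `exists_hardLayer_cutoff`)
  set M : ℕ := Fintype.card (Equiv.Perm (Fin N)) with hM
  have hM0 : 0 < (M : ℝ) := by exact_mod_cast Fintype.card_pos
  set ξ : Config N → ℝ := fun X => (∑ σ : Equiv.Perm (Fin N), ξ₀ (X ∘ σ)) / M with hξ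
  have hξeq : ξ = fun X => (M : ℝ)⁻¹ • ∑ σ : Equiv.Perm (Fin N), (ξ₀ ∘ relabelCLM σ) X := by
    funext X
    simp only [hξ, smul_eq_mul, Function.comp_apply, relabelCLM_apply]
    rw [div_eq_inv_mul]
  refine ⟨ξ, ?_, ?_, ?_, ?_, ?_, ?_, ?_, ?_⟩
  · -- `C¹`
    rw [hξeq]
    refine ContDiff.const_smul _ (ContDiff.sum fun σ _ => ?_)
    exact (hξ₀diff.comp (relabelCLM σ).contDiff).of_le (by exact_mod_cast le_top)
  · -- periodic
    intro X i k
    simp only [hξ]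
    congr 1
    refine Finset.sum_congr rfl fun σ _ => ?_
    rw [show (X + Pi.single i (EuclideanSpace.single k L)) ∘ σ = X ∘ σ + (Pi.single i (EuclideanSpace.single k L)) ∘ σ
      from rfl, single_comp_perm]
    exact hξ₀per _ _ _
  · -- symmetric
    intro τ X
    simp only [hξ]
    congr 1
    have h : ∀ σ : Equiv.Perm (Fin N), (X ∘ τ) ∘ σ = X ∘ ⇑(τ * σ) := fun σ => by
      rw [Equiv.Perm.coe_mul]; rfl
    simp only [h]
    exact Equiv.sum_comp (Equiv.mulLeft τ) (fun σ => ξ₀ (X ∘ σ))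
  · -- invariant under the diagonal translations
    intro X t
    simp only [hξ]
    congr 1
    exact Finset.sum_congr rfl fun σ _ => hξ₀tr (X ∘ σ) t
  · -- values in `[0, 1]`
    intro X
    simp only [hξ]
    refine ⟨div_nonneg (Finset.sum_nonneg fun σ _ => (hξ₀01 _).1) hM0.le, ?_⟩
    rw [div_le_one hM0]
    calc ∑ σ : Equiv.Perm (Fin N), ξ₀ (X ∘ σ) ≤ ∑ _σ : Equiv.Perm (Fin N), (1 : ℝ) :=
          Finset.sum_le_sum fun σ _ => (hξ₀01 _).2
      _ = M := by rw [Finset.sum_const, Finset.card_univ, nsmul_eq_mul, mul_one]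
  · -- vanishing on the inner layer
    intro X hX
    simp only [hξ]
    rw [Finset.sum_eq_zero fun (σ : Equiv.Perm (Fin N)) _ => hξ₀zero _ ((comp_perm_mem_hardLayer_iff σ X _).2 hX),
      zero_div]
  · -- plateau near the complement of the outer layer
    intro X hX X' hX'
    simp only [hξ]
    rw [Finset.sum_congr rfl fun (σ : Equiv.Perm (Fin N)) _ =>
      hξ₀one (X ∘ σ) (fun h => hX ((comp_perm_mem_hardLayer_iff σ X _).1 h)) (X' ∘ σ) (fun i => hX' (σ i)),
      Finset.sum_const, Finset.card_univ, nsmul_eq_mul, mul_one, div_self hM0.ne']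
  · -- gradient bound
    intro X
    have hdiff : ∀ σ : Equiv.Perm (Fin N), HasFDerivAt (ξ₀ ∘ relabelCLM σ)
        ((fderiv ℝ ξ₀ (relabelCLM σ X)).comp (relabelCLM σ)) X := fun σ =>
      (hξ₀diff.differentiable (by simp)).differentiableAt.hasFDerivAt.comp X (relabelCLM σ).hasFDerivAt
    have hsum : HasFDerivAt (fun X => ∑ σ : Equiv.Perm (Fin N), (ξ₀ ∘ relabelCLM σ) X)
        (∑ σ : Equiv.Perm (Fin N), (fderiv ℝ ξ₀ (relabelCLM σ X)).comp (relabelCLM σ)) X := by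
      have h := HasFDerivAt.sum (u := Finset.univ) fun (σ : Equiv.Perm (Fin N)) _ => hdiff σ
      rw [Finset.sum_fn] at h
      exact h
    have hξ' : HasFDerivAt ξ ((M : ℝ)⁻¹ • ∑ σ : Equiv.Perm (Fin N),
        (fderiv ℝ ξ₀ (relabelCLM σ X)).comp (relabelCLM σ)) X := by
      rw [hξeq]; exact hsum.const_smul ((M : ℝ)⁻¹)
    rw [hξ'.fderiv, norm_smul, norm_inv, Real.norm_natCast]
    calc (M : ℝ)⁻¹ * ‖∑ σ : Equiv.Perm (Fin N), (fderiv ℝ ξ₀ (relabelCLM σ X)).comp (relabelCLM σ)‖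
        ≤ (M : ℝ)⁻¹ * ∑ σ : Equiv.Perm (Fin N), ‖(fderiv ℝ ξ₀ (relabelCLM σ X)).comp (relabelCLM σ)‖ := by
          gcongr; exact norm_sum_le _ _
      _ ≤ (M : ℝ)⁻¹ * ∑ _σ : Equiv.Perm (Fin N), (40 * C / s) := by
          gcongr with σ
          calc ‖(fderiv ℝ ξ₀ (relabelCLM σ X)).comp (relabelCLM σ)‖
              ≤ ‖fderiv ℝ ξ₀ (relabelCLM σ X)‖ * ‖relabelCLM σ‖ := ContinuousLinearMap.opNorm_comp_le _ _
            _ ≤ 40 * C / s * 1 :=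
                mul_le_mul (hξ₀D' _) (norm_relabelCLM_le σ) (norm_nonneg _) (by positivity)
            _ = _ := mul_one _
      _ = 40 * C / s := by
          rw [Finset.sum_const, Finset.card_univ, nsmul_eq_mul, ← hM, ← mul_assoc, inv_mul_cancel₀ hM0.ne', one_mul]

/-! ### Zero-momentum Bose-symmetric trigonometric approximants -/

/-- **Translation-invariant Bose-symmetric classes are approximated in the (integrable) maximal form by
Bose-symmetric trigonometric polynomials of ZERO TOTAL MOMENTUM.** Let `L > 0`, `w` measurable with
`∫_{[0,L)^{3N}} W < ∞`, and `η ∈ L²((ℝ/ℤ)^{3N})` Bose-symmetric with `T_b η = η` for all `b ∈ (ℝ/ℤ)³`. For every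
`ε > 0` there is `P = ∑_{n ∈ S} aₙ eₙ` (`S` stable under the particle permutations, `a` invariant, and `aₙ = 0`
for every `n ∈ S` of non-zero total momentum `∑ᵢ n(i,·) ≠ 0`) with spectral kinetic energy at most that of `η`,
`∫ (W ∘ fromUnitTorusN L)|P|² ≤ ∫ (W ∘ fromUnitTorusN L)|η|² + ε` and `‖P - η‖ ≤ ε`: the clamp truncation commutes
with `T_b` and the dominated symmetric Fourier multiplier kills every vanishing coefficient.
[cite: ReedSimonIV1978, Thm. XIII.64] -/
theorem exists_inv_symm_trigPoly_maxForm_approx (hL : 0 < L) {w : ℝ → ℝ≥0∞} (hw : Measurable w)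
    (hWint : ∫⁻ X in cellN N L, periodicInteraction w L X ≠ ⊤) (η : L2T N)
    (hsymm : ∀ (σ : Equiv.Perm (Fin N)) (n : Fin N × Fin 3 → ℤ),
      ⟪(mFourierLp 2 (fun p : Fin N × Fin 3 => n (σ p.1, p.2)) : L2T N), η⟫_ℂ = ⟪(mFourierLp 2 n : L2T N), η⟫_ℂ)
    (hinv : ∀ b : UnitAddTorus (Fin 3), translateLp b η = η) {ε : ℝ} (hε : 0 < ε) :
    ∃ (S : Finset (Fin N × Fin 3 → ℤ)) (a : (Fin N × Fin 3 → ℤ) → ℂ),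
      (∀ (σ : Equiv.Perm (Fin N)) (n : Fin N × Fin 3 → ℤ), n ∈ S → (fun p => n (σ p.1, p.2)) ∈ S) ∧
      (∀ (σ : Equiv.Perm (Fin N)) (n : Fin N × Fin 3 → ℤ), a (fun p => n (σ p.1, p.2)) = a n) ∧
      (∀ n ∈ S, (fun k => ∑ i, n (i, k)) ≠ 0 → a n = 0) ∧
      (∑' n : Fin N × Fin 3 → ℤ, ENNReal.ofReal (∑ p, (2 * Real.pi * (n p : ℝ) / L) ^ 2) *
          (‖⟪(mFourierLp 2 n : L2T N), ∑ m ∈ S, a m • (mFourierLp 2 m : L2T N)⟫_ℂ‖₊ : ℝ≥0∞) ^ 2 ≤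
        ∑' n : Fin N × Fin 3 → ℤ, ENNReal.ofReal (∑ p, (2 * Real.pi * (n p : ℝ) / L) ^ 2) *
          (‖⟪(mFourierLp 2 n : L2T N), η⟫_ℂ‖₊ : ℝ≥0∞) ^ 2) ∧
      (∫⁻ t, periodicInteraction w L (fromUnitTorusN L t) *
          (‖((∑ m ∈ S, a m • (mFourierLp 2 m : L2T N) : L2T N) : UnitAddTorus (Fin N × Fin 3) → ℂ) t‖₊ : ℝ≥0∞) ^ 2 ≤
        (∫⁻ t, periodicInteraction w L (fromUnitTorusN L t) *
          (‖(η : UnitAddTorus (Fin N × Fin 3) → ℂ) t‖₊ : ℝ≥0∞) ^ 2) + ENNReal.ofReal ε) ∧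
      ‖(∑ m ∈ S, a m • (mFourierLp 2 m : L2T N)) - η‖ ≤ ε := by
  -- a translation-invariant truncation `f = clampC k ∘ η` within `ε/2` of `η`
  have hε2 : 0 < ε / 2 := half_pos hε
  obtain ⟨k, hk⟩ := ((tendsto_iff_norm_sub_tendsto_zero.1 (tendsto_clampLp η)).eventually (Iic_mem_nhds hε2)).exists
  set f : L2T N := (lipschitzWith_clampC (k : ℝ)).compLp (clampC_zero (Nat.cast_nonneg k)) η with hf
  have hfinv : ∀ b : UnitAddTorus (Fin 3), translateLp b f = f := fun b => by
    rw [hf, ← compLp_translateLp, hinv b]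
  have hfzero := (translateLp_eq_self_iff f).1 hfinv
  -- the dominated symmetric trigonometric polynomial for `f`
  obtain ⟨S, a, hS, ha, hdom, hpot, hdist⟩ := exists_symm_trigPoly_maxForm_approx_dominated hL hw hWint f
    (ae_norm_clampLp_le η k) (inner_symm_clampLp η k hsymm) hε2
  have ha0 : ∀ n ∈ S, (fun k => ∑ i, n (i, k)) ≠ 0 → a n = 0 := fun n hn htot => by
    have h := hdom n
    rw [hfzero n htot, norm_zero, HaarTorus.inner_mFourierLp_sum_smul, if_pos hn] at h
    exact norm_le_zero_iff.1 h
  refine ⟨S, a, hS, ha, ha0, (tsum_weight_le_of_dominated hdom _).trans (tsum_kinetic_clampLp_le η k), ?_, ?_⟩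
  · refine hpot.trans ((add_le_add (lintegral_pot_clampLp_le η k _) le_rfl).trans ?_)
    exact add_le_add le_rfl (ENNReal.ofReal_le_ofReal (by linarith))
  · calc ‖(∑ m ∈ S, a m • (mFourierLp 2 m : L2T N)) - η‖
        ≤ ‖(∑ m ∈ S, a m • (mFourierLp 2 m : L2T N)) - f‖ + ‖f - η‖ := norm_sub_le_norm_sub_add_norm_sub _ _ _
      _ ≤ ε / 2 + ε / 2 := add_le_add hdist hk
      _ = ε := add_halves ε

end Summit.AtomisticToContinuum.BoseEinsteinCondensation.Cruxes.RewardChordBound.Birth.InvariantApproximationFR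

namespace Summit.AtomisticToContinuum.BoseEinsteinCondensation.Cruxes.RewardChordBound.Birth

/-- **Helper sub-goal `stub_invariantApproximationFRCutoff` of stub R5 `stub_invariantApproximationFR`** (registered
form of `InvariantApproximationFR.exists_inv_hardLayer_cutoff`): smooth symmetric periodic hard-layer cut-offs at every
scale `s > 0`, invariant under the diagonal translations, with `‖∇ξ_s‖ ≤ C/s`. [folklore] -/
theorem stub_invariantApproximationFRCutoff :
    ∀ (N : ℕ) (v : ℝ → ENNReal) (L : ℝ), ∃ C : ℝ, 0 ≤ C ∧ ∀ s : ℝ, 0 < s →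
      ∃ ξ : Literature.MathematicalPhysics.QuantumManyBody.BoseGas.Config N → ℝ, ContDiff ℝ 1 ξ ∧
        Literature.MathematicalPhysics.QuantumManyBody.BoseGas.IsTorusPeriodic L ξ ∧
        (∀ (σ : Equiv.Perm (Fin N)) (X : Literature.MathematicalPhysics.QuantumManyBody.BoseGas.Config N),
          ξ (X ∘ σ) = ξ X) ∧
        (∀ (X : Literature.MathematicalPhysics.QuantumManyBody.BoseGas.Config N) (t : EuclideanSpace ℝ (Fin 3)),
          ξ (fun i => X i + t) = ξ X) ∧
        (∀ X, 0 ≤ ξ X ∧ ξ X ≤ 1) ∧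
        (∀ X ∈ (Literature.MathematicalPhysics.QuantumManyBody.BoseGas.hardLayer v L (s / 2) :
          Set (Literature.MathematicalPhysics.QuantumManyBody.BoseGas.Config N)), ξ X = 0) ∧
        (∀ X ∉ (Literature.MathematicalPhysics.QuantumManyBody.BoseGas.hardLayer v L s :
          Set (Literature.MathematicalPhysics.QuantumManyBody.BoseGas.Config N)),
          ∀ X' : Literature.MathematicalPhysics.QuantumManyBody.BoseGas.Config N, (∀ i, ‖X' i - X i‖ < s / 10) → ξ X' = 1) ∧
        ∀ X, ‖fderiv ℝ ξ X‖ ≤ C / s :=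
  fun _ v L => InvariantApproximationFR.exists_inv_hardLayer_cutoff v L

end Summit.AtomisticToContinuum.BoseEinsteinCondensation.Cruxes.RewardChordBound.Birth

end
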